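import Mathlib
import Summits.ValiantsHypothesis.ValiantsHypothesis.Theorems.GeneratorObstructionsPerGenDegreeSuperQPPaddedReduction

/-!
# Route GeneratorObstructions — crux K1 `PerGenDegreeSuperQP` (stmt-ValiantsHypothesis-11654), line
# `per-side-atoms`: K1 from the padded certificate on a FINAL SEGMENT of letters

Helper file (`--supports stmt-ValiantsHypothesis-11654`).  Companion of `…PerGenDegreeSuperQPPaddedReduction`
(`perGenDegreeSuperQP_of_paddedGadgetGIT`: K1 from a padded certificate at EVERY strictly monotone
placement).  Tableau certificates (`TabM.tabPoly_mem_highestWeightSpace`) live on the TOP letters, so the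
form a prover will discharge quantifies only over placements `ι : Fin (3c+1) → MatIdx m` onto an upper
set (padding letter topmost): `perGenDegreeSuperQP_of_paddedGadgetGIT_upper`.  The proof is the same
(`exists_strictMono_isUpperSet` supplies such a placement).

Honest framing: conditional reduction by name; no stub, crux or summit is settled here; `VP ≠ VNP`
untouched. [cite: GesmundoIkenmeyerPanova2017, Prop. 5]
-/

namespace Summit.ValiantsHypothesis.ValiantsHypothesis.Theorems.GeneratorObstructions.PerGenDegreeSuperQP

open MvPolynomial
open Literature.NumberTheory.DiophantineGeometry Literature.Computability.AlgebraicComplexity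
open Summit.ValiantsHypothesis.ValiantsHypothesis.Theses.GeneratorObstructions
open Summit.ValiantsHypothesis.ValiantsHypothesis.Theorems.GeneratorObstructions.SliceTransfer
open Summit.ValiantsHypothesis.ValiantsHypothesis.Theorems.GeneratorObstructions.PowGenDegreeQP
open Summit.ValiantsHypothesis.ValiantsHypothesis.Theorems.GenInheritance

-- `Summit.ValiantsHypothesis.ValiantsHypothesis.…` is the tree's mandated single-conjunct layout.
set_option linter.dupNamespace false

noncomputable section

/-- **K1 from the padded certificate on a FINAL SEGMENT** — the form a tableau certificate delivers:
the certificate is only required for placements onto an upper set (top `3c+1` letters, padding letter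
topmost). [cite: GesmundoIkenmeyerPanova2017, Prop. 5] -/
theorem perGenDegreeSuperQP_of_paddedGadgetGIT_upper
    (hGIT : ∀ (t : ℕ), 1 ≤ t → ∀ (ι : Fin (3 * 4 ^ t + 1) → MatIdx (5 * 2 ^ t * 4 ^ t + 1)),
      StrictMono ι → IsUpperSet (Set.range ι) →
      ∃ χ₀ : Weight (MatIdx (5 * 2 ^ t * 4 ^ t + 1)), (∃ a b, χ₀ a ≠ χ₀ b) ∧
        ∃ y ∈ highestWeightSpace (orbitCoordRep
            ((X (ι ⟨3 * 4 ^ t, Nat.lt_succ_self _⟩)) ^ ((4 ^ t - 1) * (5 * 2 ^ t) + 1) *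
              ∑ j : Fin (4 ^ t),
                X (ι ⟨if j.val = 0 then 0 else 3 * j.val - 1, (canonPos_lt_succ j).1⟩) ^ (2 ^ t) *
                  (X (ι ⟨3 * j.val + 1, (canonPos_lt_succ j).2.1⟩) ^ (2 * 2 ^ t) *
                    X (ι ⟨if j.val = 4 ^ t - 1 then 3 * 4 ^ t - 1 else 3 * j.val + 3,
                      (canonPos_lt_succ j).2.2⟩) ^ (2 * 2 ^ t)) :
                MvPolynomial (MatIdx (5 * 2 ^ t * 4 ^ t + 1)) ℂ) (5 * 2 ^ t * 4 ^ t + 1)) χ₀,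
          evalAtPoint ((X (ι ⟨3 * 4 ^ t, Nat.lt_succ_self _⟩)) ^ ((4 ^ t - 1) * (5 * 2 ^ t) + 1) *
              ∑ j : Fin (4 ^ t),
                X (ι ⟨if j.val = 0 then 0 else 3 * j.val - 1, (canonPos_lt_succ j).1⟩) ^ (2 ^ t) *
                  (X (ι ⟨3 * j.val + 1, (canonPos_lt_succ j).2.1⟩) ^ (2 * 2 ^ t) *
                    X (ι ⟨if j.val = 4 ^ t - 1 then 3 * 4 ^ t - 1 else 3 * j.val + 3,
                      (canonPos_lt_succ j).2.2⟩) ^ (2 * 2 ^ t)) :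
                MvPolynomial (MatIdx (5 * 2 ^ t * 4 ^ t + 1)) ℂ) (5 * 2 ^ t * 4 ^ t + 1) y ≠ 0) :
    PerGenDegreeSuperQP := by
  intro c₀ m₀
  set c₁ : ℕ := max c₀ m₀ with hc₁
  set t : ℕ := 2 * (2 * c₁ + 2 + 2) ^ 2 with htdef
  have ht1 : 1 ≤ t := by rw [htdef]; nlinarith
  have hk1 : 1 ≤ 2 ^ t := Nat.one_le_two_pow
  have hc1 : 1 ≤ 4 ^ t := Nat.one_le_pow _ _ (by norm_num)
  set m : ℕ := 5 * 2 ^ t * 4 ^ t + 1 with hmdef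
  -- a strictly monotone placement of the `3c + 1` letters exists (`3c+1 ≤ m²`)
  have hcard : Fintype.card (Fin (3 * 4 ^ t + 1)) ≤ Fintype.card (MatIdx (5 * 2 ^ t * 4 ^ t + 1)) := by
    rw [Fintype.card_fin, Fintype.card_lex, Fintype.card_prod, Fintype.card_fin]
    have hX : 3 * 4 ^ t + 1 ≤ 5 * 2 ^ t * 4 ^ t + 1 := by
      have := Nat.mul_le_mul_right (4 ^ t) (show 3 ≤ 5 * 2 ^ t by omega)
      linarith
    exact hX.trans (Nat.le_mul_self _)
  obtain ⟨ι, hι, hup⟩ := exists_strictMono_isUpperSet (σ := Fin (3 * 4 ^ t + 1))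
    (τ := MatIdx (5 * 2 ^ t * 4 ^ t + 1)) hcard
  obtain ⟨χ, -, hge, hγ⟩ := per_late_genType_of_paddedGIT (k := 2 ^ t) (c := 4 ^ t)
    (m := 5 * 2 ^ t * 4 ^ t + 1) hk1 hc1 rfl ι hι (hGIT t ht1 ι hι hup)
  refine ⟨5 * 2 ^ t * 4 ^ t + 1, ?_, χ, hγ, ?_⟩
  · -- `m₀ ≤ c₁ ≤ t ≤ 2^t ≤ m`
    have h1 : c₁ ≤ t := by rw [htdef]; nlinarith
    have h2 : t ≤ 2 ^ t := Nat.lt_two_pow_self.le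
    have h3 : m₀ ≤ c₁ := le_max_right _ _
    nlinarith [hc1]
  · -- lateness, with `c₀ ≤ c₁`
    have hlate := padded_parameters_at c₁ t htdef
    have hlog1 : 1 ≤ Nat.log 2 (5 * 2 ^ t * 4 ^ t + 1) := by
      have h : 2 ^ 1 ≤ 5 * 2 ^ t * 4 ^ t + 1 := by nlinarith [hk1, hc1]
      have := Nat.log_mono_right (b := 2) h
      rwa [Nat.log_pow (by norm_num)] at this
    have hmono : (Nat.log 2 (5 * 2 ^ t * 4 ^ t + 1) + c₀) ^ c₀ ≤
        (Nat.log 2 (5 * 2 ^ t * 4 ^ t + 1) + c₁) ^ c₁ :=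
      calc (Nat.log 2 (5 * 2 ^ t * 4 ^ t + 1) + c₀) ^ c₀
          ≤ (Nat.log 2 (5 * 2 ^ t * 4 ^ t + 1) + c₁) ^ c₀ :=
            Nat.pow_le_pow_left (by have := le_max_left c₀ m₀; omega) _
        _ ≤ (Nat.log 2 (5 * 2 ^ t * 4 ^ t + 1) + c₁) ^ c₁ :=
            Nat.pow_le_pow_right (by omega) (le_max_left _ _)
    have hlate' : (5 * 2 ^ t * 4 ^ t + 1) * 2 ^ ((Nat.log 2 (5 * 2 ^ t * 4 ^ t + 1) + c₀) ^ c₀) <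
        2 ^ (4 ^ t) :=
      lt_of_le_of_lt (Nat.mul_le_mul_left _ (Nat.pow_le_pow_right (by norm_num) hmono)) hlate
    have hcast : ((5 * 2 ^ t * 4 ^ t + 1 : ℕ) : ℤ) *
        2 ^ ((Nat.log 2 (5 * 2 ^ t * 4 ^ t + 1) + c₀) ^ c₀) < (2 : ℤ) ^ (4 ^ t) := by
      exact_mod_cast hlate'
    push_cast at hcast ⊢
    exact lt_of_lt_of_le hcast hge

end

end Summit.ValiantsHypothesis.ValiantsHypothesis.Theorems.GeneratorObstructions.PerGenDegreeSuperQP
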